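import Literature.MathematicalPhysics.QuantumFieldTheory.Balaban1983to89.B9SupplySockB9P3ZdGamma

/-!
# `Balaban1983to89.B9SupplySockB9P3ZdGammaInAk` — [Balaban1985BackgroundPropagators] (3.69) p. 404, (3.10) p. 392, Thm 3.3 p. 399 ∕ [Balaban1985RegularSpaces]
# (1.7) p. 77, (1.33) p. 82, (1.58)–(1.59) p. 86: EDITION γ·InAk OF THE J-N06→N05 JUNCTION'S Δ′-BINDER — the curvature binder stated in the SOCKET'S OWN
# 𝔄-currency (`InAk`) instead of the frame's (3.35) class, so that the GENUINE letter Δ′(U₀) (dag-n06-w2 `B9Eq369CurvSmallZd.DpZd`) discharges it by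
# name; the cube∕`Margin2`-road member supplier, its family forms and the A6 witness re-derived at that binder (threshold without `K₆` in its last entry)

statement-level skeleton of published theorems with citation tags; proofs where landed; nothing here is a claim about the
Yang–Mills mass gap

`[Balaban1985BackgroundPropagators]` ("[4]", CMP **99** (1985) 389–434) (3.10) p. 392, (3.69) p. 404 («Δ′(U₀) … a small perturbation»), (3.26)–(3.27) p. 395,
Thm 3.3 p. 399, (3.47) p. 398; `[Balaban1985RegularSpaces]` ("B8", CMP **99** (1985) 75–102) (1.7) p. 77 (the class 𝔄_k(α)), (1.33) p. 82, (1.58)–(1.59) p. 86,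
(1.131) p. 99; `[Balaban1984PropagatorsII]` (2.3) p. 224.  PDF held: `paper:balaban1985-cmp99-background-propagators`, `paper:balaban1985-cmp99-regular-spaces-gauge-fixing`.

WHY THIS FILE (cell `pub-ymgap`, seat `pub-ymgap-dag-n06-b` g16; dag-n06-w2 g0 (HUMAN RULING D-0149 width seat) ANSWER 2026-08-27T23:03Z «take (ii): the
junction's Δ′-slot becomes reading-free»; count-neutral).  dag-n06-w2 types the GENUINE curvature letter Δ′(U₀) of [4] (3.10) on the `ℤᵈ × 𝔸` carrier
(`B9Eq369CurvSmallZd.DpZd`) and PROVES its (3.69) bound from B8's small-field datum `InAk L m η α₀ Ω U₀` alone (`curvSmall_inAk_of_Dp_eq_M`: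
`(Lʲη)³‖(Δ′(U₀)A)(b)‖ ≤ 14(d−1)·M·α₀·|A|₍₋₁₎`).  This lineage's binder `B9SupplySockB9P3ZdAt.CurvAt` asks the same inequality under the FRAME's (3.35) class
`Reg335 c35 α₀` (fed from `InAk` through `Prop6At` at scale `K₆α₀`) — a reading the `ℤᵈ` frames do not carry on plaquettes from the `ZdIdx` axioms alone.  Since the
socket's datum already IS `InAk … α₀ … U₀`, the supplier can take the Δ′ bound at the datum's own `α₀` with NO frame reading: this file states that binder
(`CurvAtInAk`, the shape dag-n06-w2 discharges verbatim) and re-derives `B9SupplySockB9P3ZdGamma`'s cube-road supplier at it.  Only the Δ′-slot changes;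
every other binder (dictionary, `Prop6At`, `InvAt`, `LandauAt`, `AvgAtγ`, `SeesDom`) and the socket are edition γ's.

WHAT IS PROVED (kernel, 0 sorry; 1 definition + theorems; no `instance`, no `notation`).
* §1 ★ `CurvAtInAk L ops c69 M i m` — «∀ α₀ > 0, ∀ unitary U₀ with `InAk L m i.η α₀ i.Ω U₀`, ∀ A ∈ E(Ω₀), ∀ bonds b of Ω_j (j ≤ m):
  (Lʲη)³‖(Δ′(U₀)A)(b)‖ ≤ c₆₉·M·α₀·|A|₍₋₁₎» (= `CurvAt` :108–113 with the `Reg335` line replaced by `InAk` and the guard `M·α₀ ≤ a₃` dropped).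
* §2 ★★ `sockB9P3D4γI_at` — `B9SupplySockB9P3ZdGamma.sockB9P3D4γ_at` re-proved VERBATIM with `hcurv : CurvAtInAk …` applied at the datum's `α₀` (instead of at
  `K₆α₀` via `Prop6At`∕`Reg335`), hence the threshold `cP = min{1∕16, c₆∕M, a₀∕(K₆M), a₃∕(K₆M), 1∕(2B₀c₆₉M+1)}` (last entry without `K₆`); `B₀′ = max{1, 2B₀max{1,q}}`,
  `B_∂ = (20d+2)B₀′` unchanged; ★ `sockB9P3D4γI_allLevels_of_thm33_on` ∕ `sockB9P3D4γI_allLevels_explicit_on`.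
* §3 A6 (director-ym №189 (3)): ★★ `Witness.binders_inhabited_cube_zero_γI` (`Δ′ := 0` inhabits `CurvAtInAk` trivially; the rest is edition γ's witness by import) +
  `Witness.binders_inhabited_cubeLamBP_zero_I` (print's class).  (The socket's non-vacuity corollaries at `m = 0` are edition γ's
  `B9SupplySockB9P3ZdGamma.Witness.sockB9P3D4γ_at_nonvacuous_*` — same statements, not restated.)

HONEST SCOPE.  Re-typing of ONE binder of this lineage into the socket's currency + re-derivation + A6 at `m = 0`; NO estimate of [4]∕[B8] proved here (the
genuine Δ′ and its bound are dag-n06-w2's file); the other letters (G(U₀), DR(U₀)D*, Q*aQ) remain parameters with displayed binders; the `m ≥ 1` inhabitation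
at print's class = N06's object layer; count-neutral; N05∕N06 NOT discharged; nothing continuum ∕ ℝ⁴ ∕ OS ∕ mass-gap ∕ Clay.  Unit `pub-ymgap-dag-n06-b` (g16), 2026-08-27.
-/

noncomputable section

open NormedSpace

namespace Literature.MathematicalPhysics.QuantumFieldTheory.Balaban1983to89.B9SupplySockB9P3ZdGammaInAk

open B7Prop1Explicit (e U1)
open B7Prop1Local (InBox loK bondHiK)
open B7Prop2Explicit (unitaryUnits unitaryUnits_le_U1)
open B7Prop4GeneralLevels (linCovIter)
open B7Eq78Linearization (conjR)
open B8Ineq132 (covDerivFwd covDeriv InAk BondTouches)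
open B8Eq140Level (SideTouches)
open B8Eq146AExpansion (iEta plaqCovDeriv)
open B8Eq143PlaqExpansion (pdiv)
open B8Eq155JBound (Jcur wsup)
open B8ScaledSupNorm (bondNorm msup weight Bdd)
open B8Eq138LandauZd (IsLandau138 IsLandau138W QT covDivB logCfg covLap)
open B8Eq184Proof (cfgExp)
open B8Lemma1NonAbelian (mulCfg)
open B8LeafModelZd (ZdIdx)
open B9SupplySockB9P3ZdLetters (OpsZd deltaAOf)
open B9SupplySockB9P3ZdLettersOmega (OnDom restrictDom outerPart Margin2 restrictDom_of)
open B9SupplySockB9P3ZdOmega (collar_arith)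
open B9SupplySockB9P3ZdAt (DictAt Prop6At InvAt CurvAt LandauAt)
open B9SupplySockB9P3ZdBeta (CrossB SockB9P3D4β AvgAtβ)
open B8Eq131CubesAdmissible (cubeFam cubeFam_false_zero)
open B8Eq131Cubes (cube sqLo sqHi cube_anti)
open B8CubeMemberZd (cubeLamB)
open B8Ineq159FlatCubeMemberPrinted (cubeLamBP cubeLamBP_box_subset_pred cubeLamBP_zero_bondTouches)
open B9SupplySockB9P3ZdGamma (SeesDom AvgAtγ wsupB1γ_restrictDom seesDom_zero_of_touch seesDom_cubeLamBP cubeLamBP' seesDom_cubeLamBP'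
  mem_cubeLamBP_zero_of_bondTouches mem_cubeLamBP'_zero_of_inner cubeLamBP'_zero_bondTouches)

export B7Prop1Explicit (Site)

variable {d : ℕ}
variable {𝔸 : Type*} [CStarAlgebra 𝔸]

/-! ## §1 The curvature binder in the socket's own (1.7)∕(1.33) currency -/

section Binder

variable (L : ℕ)

/-- ★ **THE CURVATURE CORRECTION Δ′(U₀) IS SMALL FOR `U₀ ∈ 𝔄_m(α₀)`, AT ONE MEMBER — IN THE SOCKET'S OWN CURRENCY** — `B9SupplySockB9P3ZdAt.CurvAt` with its
frame-side hypothesis «`(bg …).Reg335 c35 α₀ (ιCfg … U₀ …)`» (and the guard `M·α₀ ≤ a₃`) REPLACED by the (1.7)∕(1.33) datum the socket itself carries,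
`InAk L m i.η α₀ i.Ω U₀`: for every `α₀ > 0` and every unitary `U₀ ∈ 𝔄_m(α₀)`, every `A ∈ E(Ω₀)` and every bond `b` of `Ω_j`, `j ≤ m`:
`(Lʲη)³‖(Δ′(U₀)A)(b)‖ ≤ c₆₉·M·α₀·|A|₍₋₁₎` ([4] (3.69) «Δ′(U₀) is a small perturbation», read in B8's 𝔄-currency; dag-n06-w2's
`B9Eq369CurvSmallZd.curvSmall_inAk_of_Dp_eq_M` discharges it for the GENUINE letter `Δ′ := DpZd`, with `c₆₉ = 14(d−1)`).
[cite: Balaban1985BackgroundPropagators, (3.69) p.404, (3.10) p.392; Balaban1985RegularSpaces, (1.7) p.77, (1.33) p.82, (1.58) p.86] -/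
def CurvAtInAk (ops : ℝ → ZdIdx d L → ℕ → OpsZd d 𝔸) (c69 : ℝ) (M : ℝ) (i : ZdIdx d L) (m : ℕ) : Prop :=
  ∀ (α₀ : ℝ) (U₀ : Site d → Fin d → 𝔸ˣ), (∀ x κ, U₀ x κ ∈ unitaryUnits 𝔸) → 0 < α₀ → InAk L m i.η α₀ i.Ω U₀ →
    ∀ A : Site d → Fin d → 𝔸, OnDom L m i.η i.Ω A → ∀ j, j ≤ m → ∀ (x : Site d) (μ : Fin d), BondTouches (i.Ω j) x μ →
      ((L : ℝ) ^ j * i.η) ^ 3 * ‖(ops M i m).Dp U₀ A x μ‖ ≤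
        c69 * M * α₀ * msup L m i.η (-(1 : ℝ)) (fun j (b : Site d × Fin d) => SideTouches (i.Ω j) b.1 b.2) (fun b => A b.1 b.2)

end Binder

/-! ## §3 The member supplier at a supplied datum class ([4] Theorem 3.3 ⇒ the four-line collar socket at `ΛbP`) and its family forms -/

section Supply

variable [Nontrivial 𝔸]
variable {I : Type} (geo : I → B9.Geometry) (bg : I → B9.Backgrounds) (GA : ∀ i, B9.KernelFamily (geo i) (bg i))
variable (L : ℕ) (mem : ℝ → ZdIdx d L → ℕ → I)
variable (ιCfg : ∀ (M : ℝ) (i : ZdIdx d L) (m : ℕ) (U₀ : Site d → Fin d → 𝔸ˣ),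
  (∀ x κ, U₀ x κ ∈ unitaryUnits 𝔸) → (bg (mem M i m)).Cfg)
variable (ιLoc : ∀ (M : ℝ) (i : ZdIdx d L) (m : ℕ), (Site d → Fin d → 𝔸) → (geo (mem M i m)).Loc)
variable (ops : ℝ → ZdIdx d L → ℕ → OpsZd d 𝔸)

set_option maxHeartbeats 400000 in
/-- ★★ **(Δ′-BINDER IN THE 𝔄-CURRENCY: `CurvAtInAk`; threshold without `K₆` in its last entry.)  THEOREM 3.3 FOR G(U₀) AT ONE MEMBER WITH `Margin2`
SUPPLIES THE β COLLAR SOCKET AT ANY DATUM CLASS `ΛbP` THAT IS READ INSIDE `Ω₀`** — `B9SupplySockB9P3ZdGamma.sockB9P3D4γ_at` re-proved VERBATIM with the Δ′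
bound taken at the datum's own `α₀` from `InAk` (so `cP = min{1∕16, c₆∕M, a₀∕(K₆M), a₃∕(K₆M), 1∕(2B₀c₆₉M+1)}`); otherwise:
`B9SupplySockB9P3ZdBeta.sockB9P3D4β_at` re-proved VERBATIM with the averaging datum class an explicit PARAMETER `ΛbP` (binder `AvgAtγ … ΛbP`, socket
`SockB9P3D4β … ΛbP`) instead of the member's law field `i.Λb`, under the locality law `SeesDom L m (i.Ω 0) ΛbP` (which replaces the internal use of
`ZdIdx.hbox`; the hypothesis `m ≤ i.k` of the β form is therefore not needed); same constants B₀′ = max{1, 2B₀max{1,q}}, B_∂ = (20d+2)B₀′,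
cP = min{1∕16, c₆∕M, a₀∕(K₆M), a₃∕(K₆M), 1∕(2B₀c₆₉K₆M+1)} (B8 p. 86 «Theorem 3.3 of [4] implies the bounds (1.59)», on E(Ω₀), with the Δ′-transfer and the
collar bookkeeping).  At `ΛbP :=` print's class [B6] (2.3) ∕ (1.31) (inner AND crossing bonds — at the cube member `B8Ineq159FlatCubeMemberPrinted.cubeLamBP`,
law by `seesDom_cubeLamBP`) this is EDITION γ of the junction's member supplier.
[cite: Balaban1985RegularSpaces, (1.58)–(1.59) p.86, (1.31) p.82, Prop. 3 p.87, p.77; Balaban1985BackgroundPropagators, Thm 3.3 p.399, (3.26)–(3.27) p.395, (3.47) p.398, (3.69) p.404; Balaban1984PropagatorsII, (2.3) p.224] -/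
theorem sockB9P3D4γI_at (hd2 : 2 ≤ d) (hL : 1 ≤ L) {c35 c₆ K₆ a₃ c69 q : ℝ}
    {M : ℝ} (hM1 : 1 ≤ M) (i : ZdIdx d L) (hMi : Margin2 i.Ω) {m : ℕ}
    (hdict : DictAt geo bg GA L mem ιCfg ιLoc ops M i m) (hP6 : Prop6At bg L mem ιCfg c35 c₆ K₆ M i m)
    (hinv : InvAt bg L mem ιCfg ops c35 a₃ M i m) (hcurv : CurvAtInAk L ops c69 M i m)
    (hlan : LandauAt bg L mem ιCfg ops c35 a₃ M i m)
    (ΛbP : ℕ → ℕ → Set (Site d × Fin d)) (havg : AvgAtγ L ops q ΛbP M i m) (hsee : SeesDom L m (i.Ω 0) ΛbP)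
    (hK₆ : 0 < K₆) (hc69 : 0 ≤ c69) (hq : 0 ≤ q)
    {B₀ δ₀ a₀ : ℝ} (hB₀ : 0 < B₀)
    (h33U : ∀ (α₀ : ℝ) (U₀ : Site d → Fin d → 𝔸ˣ) (hU₀ : ∀ x κ, U₀ x κ ∈ unitaryUnits 𝔸), 0 < α₀ → M * α₀ ≤ a₀ →
      (bg (mem M i m)).Reg335 c35 α₀ (ιCfg M i m U₀ hU₀) →
      B9.Ineq342_346_347 (GA (mem M i m)) B₀ δ₀ (ιCfg M i m U₀ hU₀)) :
    SockB9P3D4β (𝔸 := 𝔸) L (max 1 (2 * B₀ * max 1 q)) ((20 * d + 2) * max 1 (2 * B₀ * max 1 q))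
      (min (1 / 16) (min (c₆ / M) (min (a₀ / (K₆ * M)) (min (a₃ / (K₆ * M)) (1 / (2 * B₀ * c69 * M + 1))))))
      i.η m i.Ω i.Λs ΛbP := by
  intro α₀ α₂ hα₀ hα₀c hα₂ hα₂c U₀ W hU₀ hWu hInA _ hLanW A' _ h41 hA0
  -- the thresholds
  have hη : 0 < i.η := i.hη
  have hLr : (1 : ℝ) ≤ L := by exact_mod_cast hL
  have hd1 : (1 : ℝ) ≤ d := by exact_mod_cast (le_trans (by norm_num) hd2 : 1 ≤ d)
  have hM0 : 0 < M := lt_of_lt_of_le one_pos hM1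
  have hKM : 0 < K₆ * M := mul_pos hK₆ hM0
  simp only [le_min_iff] at hα₀c hα₂c
  obtain ⟨-, hα₀c6, hα₀a0, hα₀a3, hα₀θ⟩ := hα₀c
  obtain ⟨hα₂16, -, -, -, -⟩ := hα₂c
  have hc6 : M * α₀ ≤ c₆ := by rw [mul_comm]; exact (le_div_iff₀ hM0).1 hα₀c6
  have ha₉0 : 0 < K₆ * α₀ := mul_pos hK₆ hα₀
  have ha0' : M * (K₆ * α₀) ≤ a₀ := by
    have h := (le_div_iff₀ hKM).1 hα₀a0
    calc M * (K₆ * α₀) = α₀ * (K₆ * M) := by ring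
      _ ≤ a₀ := h
  have ha3' : M * (K₆ * α₀) ≤ a₃ := by
    have h := (le_div_iff₀ hKM).1 hα₀a3
    calc M * (K₆ * α₀) = α₀ * (K₆ * M) := by ring
      _ ≤ a₃ := h
  have hκ' : 0 ≤ c69 * M * α₀ := by positivity
  have hθ : B₀ * (c69 * M * α₀) ≤ 1 / 2 := by
    have hpos : 0 < 2 * B₀ * c69 * M + 1 := by positivity
    have h1 : α₀ * (2 * B₀ * c69 * M + 1) ≤ 1 := (le_div_iff₀ hpos).1 hα₀θ
    linarith [hα₀.le]
  -- (3.35) for U₀ by Proposition 6, and Theorem 3.3's (3.42)–(3.47) block for G(U₀)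
  have hreg : (bg (mem M i m)).Reg335 c35 (K₆ * α₀) (ιCfg M i m U₀ hU₀) := hP6 α₀ U₀ hU₀ hα₀ hc6 hInA
  have h347 := h33U (K₆ * α₀) U₀ hU₀ ha₉0 ha0' hreg
  obtain ⟨-, hd⟩ := hdict
  have hU₀1 : ∀ x κ, U₀ x κ ∈ U1 𝔸 := fun x κ => unitaryUnits_le_U1 (hU₀ x κ)
  -- the datum and its restriction to the Ω₀-bonds
  have hAglob : ∀ (y : Site d) (τ : Fin d), ‖A' y τ‖ ≤ α₂ * i.η⁻¹ := by
    intro y τ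
    by_cases hmem : ∃ j, j ≤ m ∧ SideTouches (i.Ω j) y τ
    · obtain ⟨j, hj, hs⟩ := hmem
      have hLj : (1 : ℝ) ≤ (L : ℝ) ^ j := one_le_pow₀ hLr
      calc ‖A' y τ‖ ≤ α₂ * ((L : ℝ) ^ j * i.η)⁻¹ := (h41 j hj y τ hs).2
        _ = α₂ * i.η⁻¹ * ((L : ℝ) ^ j)⁻¹ := by rw [mul_inv]; ring
        _ ≤ α₂ * i.η⁻¹ * 1 := by
            apply mul_le_mul_of_nonneg_left (inv_le_one_of_one_le₀ hLj) (by positivity)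
        _ = α₂ * i.η⁻¹ := mul_one _
    · rw [hA0 y τ fun j hj hs => hmem ⟨j, hj, hs⟩, norm_zero]
      positivity
  have hAbd : Bdd L m i.η (-(1 : ℝ)) (fun j (b : Site d × Fin d) => SideTouches (i.Ω j) b.1 b.2) (fun b => A' b.1 b.2) := by
    have e1 : (-(1 : ℝ)) = -((1 : ℕ) : ℝ) := by norm_num
    rw [e1]
    refine B8ScaledSupNorm.bdd_of_forall (c := α₂) fun j hj b hb => ?_
    rw [B8ScaledSupNorm.weight_neg_natCast, pow_one]
    have h := (h41 j hj b.1 b.2 hb).2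
    have hs : 0 < (L : ℝ) ^ j * i.η := B8ScaledSupNorm.scale_pos hL hη j
    calc (L : ℝ) ^ j * i.η * ‖A' b.1 b.2‖ ≤ (L : ℝ) ^ j * i.η * (α₂ * ((L : ℝ) ^ j * i.η)⁻¹) :=
          mul_le_mul_of_nonneg_left h hs.le
      _ = α₂ := by rw [mul_comm α₂, ← mul_assoc, mul_inv_cancel₀ hs.ne', one_mul]
  obtain ⟨Ain, hAin_def⟩ : ∃ Ain : Site d → Fin d → 𝔸, Ain = restrictDom (i.Ω 0) A' := ⟨_, rfl⟩
  have h41b : ∀ j, j ≤ m → ∀ (y : Site d) (τ : Fin d), SideTouches (i.Ω j) y τ → ‖A' y τ‖ ≤ α₂ * ((L : ℝ) ^ j * i.η)⁻¹ :=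
    fun j hj y τ hs => (h41 j hj y τ hs).2
  have hOn : OnDom L m i.η i.Ω Ain := by
    rw [hAin_def]; exact B9SupplySockB9P3ZdLettersOmega.onDom_restrictDom hL hη h41b
  have hAin_glob : ∀ (y : Site d) (τ : Fin d), ‖Ain y τ‖ ≤ α₂ * i.η⁻¹ := fun y τ => by
    rw [hAin_def]; exact (B9SupplySockB9P3ZdLettersOmega.norm_restrictDom_le _ A' y τ).trans (hAglob y τ)
  obtain ⟨a, ha_def⟩ : ∃ a : ℝ,
      a = msup L m i.η (-(1 : ℝ)) (fun j (b : Site d × Fin d) => SideTouches (i.Ω j) b.1 b.2) (fun b => Ain b.1 b.2) := ⟨_, rfl⟩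
  have ha0 : 0 ≤ a := by rw [ha_def]; exact B8ScaledSupNorm.msup_nonneg L m hη.le _ _ _
  -- the collar functional Φ₀ and the pointwise control of the outer part
  obtain ⟨Φ, hΦ_def⟩ : ∃ Φ : ℝ, Φ = msup L m i.η (-(1 : ℝ))
      (fun j (b : Site d × Fin d) => j = 0 ∧ SideTouches (i.Ω 0) b.1 b.2 ∧ ¬ BondTouches (i.Ω 0) b.1 b.2) (fun b => A' b.1 b.2) := ⟨_, rfl⟩
  have hΦ0 : 0 ≤ Φ := by rw [hΦ_def]; exact B8ScaledSupNorm.msup_nonneg L m hη.le _ _ _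
  have hbdΦ : Bdd L m i.η (-(1 : ℝ))
      (fun j (b : Site d × Fin d) => j = 0 ∧ SideTouches (i.Ω 0) b.1 b.2 ∧ ¬ BondTouches (i.Ω 0) b.1 b.2) (fun b => A' b.1 b.2) := by
    have e1 : (-(1 : ℝ)) = -((1 : ℕ) : ℝ) := by norm_num
    rw [e1]
    exact B9SupplySockB9P3ZdLettersOmega.bdd_neg_of_pointwise hL hη 1 fun b => hAglob b.1 b.2
  have hout : ∀ (y : Site d) (τ : Fin d), ‖outerPart (i.Ω 0) A' y τ‖ ≤ i.η⁻¹ * Φ := by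
    intro y τ; rw [hΦ_def]
    exact B9SupplySockB9P3ZdLettersOmega.norm_outerPart_le_phi hη hMi hA0 hbdΦ y τ
  -- the Landau condition for A′, hence for 𝟙_{Ω₀}A′; the source J̃ = Δ_a(U₀)𝟙_{Ω₀}A′ and 𝟙_{Ω₀}A′ = G(U₀)J̃ ((1.58))
  have hLanA : IsLandau138 L m i.η (i.Ω 0) (i.Λs m) U₀ A' :=
    B9SupplySockB9P3Zd.landau_of_landauW hd2 hη U₀ hWu hα₂16 h41 hLanW
  have hLanAin : IsLandau138 L m i.η (i.Ω 0) (i.Λs m) U₀ Ain := by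
    rw [hAin_def]; exact (B9SupplySockB9P3ZdLettersOmega.isLandau138_restrictDom_iff L m i.η (i.Ω 0) (i.Λs m) U₀ A').2 hLanA
  obtain ⟨Jt, hJt_def⟩ : ∃ Jt : Site d → Fin d → 𝔸, Jt = deltaAOf i.η (ops M i m) U₀ Ain := ⟨_, rfl⟩
  have hGJ : (ops M i m).Gop U₀ Jt = Ain :=
    hinv (K₆ * α₀) U₀ hU₀ ha₉0 ha3' hreg Ain hOn Jt fun y τ _ => by rw [hJt_def]
  have hDRD : ∀ (x : Site d) (μ : Fin d), (ops M i m).DRDs U₀ Ain x μ = 0 :=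
    hlan (K₆ * α₀) U₀ hU₀ ha₉0 ha3' hreg Ain hOn hLanAin
  have hJtb : ∀ (x : Site d) (μ : Fin d),
      Jt x μ = Jcur i.η U₀ Ain μ x + (ops M i m).Dp U₀ Ain x μ + (ops M i m).DRDs U₀ Ain x μ + (ops M i m).QQ U₀ Ain x μ := by
    intro x μ; rw [hJt_def]; rfl
  -- the right-hand side quantities: |J|₍₋₃₎ of the datum, |J(𝟙_{Ω₀}A′)|₍₋₃₎, |B₁|
  obtain ⟨nJ, hnJ_def⟩ : ∃ nJ : ℝ, nJ = bondNorm L m i.η (-(3 : ℝ)) i.Ω (fun x μ => Jcur i.η U₀ A' μ x) := ⟨_, rfl⟩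
  obtain ⟨nJi, hnJi_def⟩ : ∃ nJi : ℝ, nJi = bondNorm L m i.η (-(3 : ℝ)) i.Ω (fun x μ => Jcur i.η U₀ Ain μ x) := ⟨_, rfl⟩
  obtain ⟨nB, hnB_def⟩ : ∃ nB : ℝ, nB = wsup 1 (fun p : {p : ℕ × (Site d × Fin d) // p.1 ≤ m ∧ (p.2 ∈ ΛbP m p.1 ∨ (p.1 = 0 ∧ CrossB (i.Ω 0) p.2))} =>
      linCovIter L U₀ (iEta i.η A') p.1.1 p.1.2.1 p.1.2.2) := ⟨_, rfl⟩
  have hnJ0 : 0 ≤ nJ := by rw [hnJ_def]; exact B8ScaledSupNorm.msup_nonneg L m hη.le _ _ _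
  have hnB0 : 0 ≤ nB := by rw [hnB_def]; exact B8Eq155JBound.wsup_nonneg zero_le_one _
  have hnB_eq : wsup 1 (fun p : {p : ℕ × (Site d × Fin d) // p.1 ≤ m ∧ (p.2 ∈ ΛbP m p.1 ∨ (p.1 = 0 ∧ CrossB (i.Ω 0) p.2))} =>
      linCovIter L U₀ (iEta i.η Ain) p.1.1 p.1.2.1 p.1.2.2) = nB := by
    rw [hnB_def, hAin_def]
    exact wsupB1γ_restrictDom hL m i.η hsee U₀ A'
  -- |J(𝟙_{Ω₀}A′)|₍₋₃₎ ≤ |J(A′)|₍₋₃₎ + 16dΦ (the outer part sits at level 0)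
  have hnJi_le : nJi ≤ nJ + 16 * d * Φ := by
    rw [hnJi_def, hnJ_def, hAin_def]
    exact B9SupplySockB9P3ZdLettersOmega.bondNorm_jcur_restrict_le hL hη hMi hU₀1 hΦ0 hout hAglob
  -- the current of 𝟙_{Ω₀}A′ is bounded
  have hgrad : ∀ (y : Site d) (κ τ : Fin d), ‖covDerivFwd i.η U₀ κ (fun z => Ain z τ) y‖ ≤ i.η⁻¹ * (α₂ * i.η⁻¹ + α₂ * i.η⁻¹) :=
    fun y κ τ => (B9SupplySockB9P3ZdLettersOmega.norm_covDerivFwd_le hη (hU₀1 _ _) _).trans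
      (mul_le_mul_of_nonneg_left (add_le_add (hAin_glob _ _) (hAin_glob _ _)) (inv_nonneg.mpr hη.le))
  have hJbd : Bdd L m i.η (-(3 : ℝ)) (fun j (b : Site d × Fin d) => BondTouches (i.Ω j) b.1 b.2)
      (fun b => Jcur i.η U₀ Ain b.2 b.1) :=
    B9SupplySockB9P3Zd.bdd_neg_three_of_pointwise hL hη fun b => B9SupplySockB9P3Zd.norm_Jcur_le_of_grad hη hU₀1 hgrad b.2 b.1
  -- |J̃|₍₋₃₎ ≤ |J(𝟙_{Ω₀}A′)|₍₋₃₎ + c₆₉ M α₀ |𝟙_{Ω₀}A′|₍₋₁₎ + q |B₁| (pointwise: (3.26) with (3.69), the Landau condition, (3.16))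
  have hJt : bondNorm L m i.η (-(3 : ℝ)) i.Ω Jt ≤ nJi + c69 * M * α₀ * a + q * nB := by
    have e3 : (-(3 : ℝ)) = -((3 : ℕ) : ℝ) := by norm_num
    have hnJi0 : 0 ≤ nJi := by rw [hnJi_def]; exact B8ScaledSupNorm.msup_nonneg L m hη.le _ _ _
    refine B8ScaledSupNorm.msup_le (by positivity) fun j hj b hb => ?_
    have hw : weight L i.η (-(3 : ℝ)) j = ((L : ℝ) ^ j * i.η) ^ 3 := by
      rw [e3, B8ScaledSupNorm.weight_neg_natCast]
    have hw0 : 0 ≤ ((L : ℝ) ^ j * i.η) ^ 3 := by positivity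
    have h1 : weight L i.η (-(3 : ℝ)) j * ‖Jcur i.η U₀ Ain b.2 b.1‖ ≤ nJi := by
      rw [hnJi_def]; exact B8ScaledSupNorm.weight_mul_norm_le_msup hJbd hj hb
    have h2 : ((L : ℝ) ^ j * i.η) ^ 3 * ‖(ops M i m).Dp U₀ Ain b.1 b.2‖ ≤ c69 * M * α₀ * a := by
      rw [ha_def]; exact hcurv α₀ U₀ hU₀ hα₀ hInA Ain hOn j hj b.1 b.2 hb
    have h4 : ((L : ℝ) ^ j * i.η) ^ 3 * ‖(ops M i m).QQ U₀ Ain b.1 b.2‖ ≤ q * nB := by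
      rw [← hnB_eq]; exact havg U₀ hU₀ Ain hOn j hj b.1 b.2 hb
    have hsum : ‖Jt b.1 b.2‖ ≤
        ‖Jcur i.η U₀ Ain b.2 b.1‖ + ‖(ops M i m).Dp U₀ Ain b.1 b.2‖ + ‖(ops M i m).QQ U₀ Ain b.1 b.2‖ := by
      rw [hJtb, hDRD b.1 b.2, add_zero]
      exact norm_add₃_le
    rw [hw] at h1 ⊢
    calc ((L : ℝ) ^ j * i.η) ^ 3 * ‖Jt b.1 b.2‖
        ≤ ((L : ℝ) ^ j * i.η) ^ 3 *
            (‖Jcur i.η U₀ Ain b.2 b.1‖ + ‖(ops M i m).Dp U₀ Ain b.1 b.2‖ + ‖(ops M i m).QQ U₀ Ain b.1 b.2‖) :=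
          mul_le_mul_of_nonneg_left hsum hw0
      _ = ((L : ℝ) ^ j * i.η) ^ 3 * ‖Jcur i.η U₀ Ain b.2 b.1‖ + ((L : ℝ) ^ j * i.η) ^ 3 * ‖(ops M i m).Dp U₀ Ain b.1 b.2‖ +
            ((L : ℝ) ^ j * i.η) ^ 3 * ‖(ops M i m).QQ U₀ Ain b.1 b.2‖ := by ring
      _ ≤ nJi + c69 * M * α₀ * a + q * nB := add_le_add (add_le_add h1 h2) h4
  -- Theorem 3.3's γ = −3 entries at J̃ through the dictionary ((3.47) ⇒ (1.59) for 𝟙_{Ω₀}A′)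
  obtain ⟨hw, hG0, hG1, hG3⟩ := hd U₀ hU₀ Jt
  have hline1 : a ≤ B₀ * bondNorm L m i.η (-(3 : ℝ)) i.Ω Jt := by
    have h := B9.glob_at_minus_three (GA (mem M i m)) h347 0 (ιLoc M i m Jt)
    rw [hG0, hw, hGJ, ← ha_def] at h
    exact h
  have hline2 : msup L m i.η (-(2 : ℝ)) (fun j (t : Fin d × Fin d × Site d) => SideTouches (i.Ω j) t.2.2 t.2.1)
      (fun t => covDerivFwd i.η U₀ t.1 (fun z => Ain z t.2.1) t.2.2) ≤ B₀ * bondNorm L m i.η (-(3 : ℝ)) i.Ω Jt := by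
    have h := B9.glob_at_minus_three (GA (mem M i m)) h347 1 (ιLoc M i m Jt)
    rw [hG1, hw, hGJ] at h
    exact h
  have hline4 : bondNorm L m i.η (-(3 : ℝ)) i.Ω (fun x μ => covLap i.η U₀ (fun z => Ain z μ) x) ≤
      B₀ * bondNorm L m i.η (-(3 : ℝ)) i.Ω Jt := by
    have h := B9.glob_at_minus_three (GA (mem M i m)) h347 3 (ιLoc M i m Jt)
    rw [hG3, hw, hGJ] at h
    exact h
  -- the a-priori (Neumann) step of G-IF-01 for 𝟙_{Ω₀}A′ with the source norm nJ + 16dΦ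
  have hN : bondNorm L m i.η (-(3 : ℝ)) i.Ω Jt ≤ (nJ + 16 * d * Φ) + c69 * M * α₀ * a + q * nB := by
    linarith only [hJt, hnJi_le]
  have hnJ1 : 0 ≤ nJ + 16 * d * Φ := by positivity
  obtain ⟨hA1, hA2, -, hA4, -⟩ := B9SupplySockB9P3Zd.apriori_arith (h := 0) (Cβ := 0) hB₀ hq hκ' hθ ha0 hnJ1 hnB0 le_rfl rfl hN hline1 hline2
    hline4 (by rw [zero_mul])
  -- bookkeeping constants
  obtain ⟨B', hB'_def⟩ : ∃ B' : ℝ, B' = max 1 (2 * B₀ * max 1 q) := ⟨_, rfl⟩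
  have hB'1 : 1 ≤ B' := by rw [hB'_def]; exact le_max_left _ _
  rw [← hB'_def] at hA1 hA2 hA4 ⊢
  -- the four lines for A′ = 𝟙_{Ω₀}A′ + outer part
  have hL1 : msup L m i.η (-(1 : ℝ)) (fun j (b : Site d × Fin d) => SideTouches (i.Ω j) b.1 b.2) (fun b => A' b.1 b.2) ≤ a + Φ := by
    rw [ha_def, hAin_def]
    exact B9SupplySockB9P3ZdLettersOmega.msup_side_le_restrict_add hη hMi hΦ0 hout hAbd
  have hL2 : msup L m i.η (-(2 : ℝ)) (fun j (t : Fin d × Fin d × Site d) => SideTouches (i.Ω j) t.2.2 t.2.1)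
      (fun t => covDerivFwd i.η U₀ t.1 (fun z => A' z t.2.1) t.2.2) ≤
      msup L m i.η (-(2 : ℝ)) (fun j (t : Fin d × Fin d × Site d) => SideTouches (i.Ω j) t.2.2 t.2.1)
        (fun t => covDerivFwd i.η U₀ t.1 (fun z => Ain z t.2.1) t.2.2) + 2 * Φ := by
    rw [hAin_def]
    exact B9SupplySockB9P3ZdLettersOmega.msup_grad_le_restrict_add hL hη hMi hU₀1 hΦ0 hout hAglob
  have hL4 : bondNorm L m i.η (-(3 : ℝ)) i.Ω (fun x μ => covLap i.η U₀ (fun z => A' z μ) x) ≤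
      bondNorm L m i.η (-(3 : ℝ)) i.Ω (fun x μ => covLap i.η U₀ (fun z => Ain z μ) x) + 4 * d * Φ := by
    rw [hAin_def]
    exact B9SupplySockB9P3ZdLettersOmega.bondNorm_covLap_le_restrict_add hL hη hMi hU₀1 hΦ0 hout hAglob
  have hJJ : bondNorm L m i.η (-(3 : ℝ)) i.Ω (fun x μ => pdiv i.η U₀ (plaqCovDeriv i.η U₀ A') μ x) = nJ := by
    rw [hnJ_def]; rfl
  -- name the remaining large terms, so that the final arithmetic runs on atoms
  obtain ⟨l1, hl1_def⟩ : ∃ l1 : ℝ,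
      l1 = msup L m i.η (-(1 : ℝ)) (fun j (b : Site d × Fin d) => SideTouches (i.Ω j) b.1 b.2) (fun b => A' b.1 b.2) := ⟨_, rfl⟩
  obtain ⟨l2, hl2_def⟩ : ∃ l2 : ℝ, l2 = msup L m i.η (-(2 : ℝ)) (fun j (t : Fin d × Fin d × Site d) => SideTouches (i.Ω j) t.2.2 t.2.1)
      (fun t => covDerivFwd i.η U₀ t.1 (fun z => A' z t.2.1) t.2.2) := ⟨_, rfl⟩
  obtain ⟨g2, hg2_def⟩ : ∃ g2 : ℝ, g2 = msup L m i.η (-(2 : ℝ)) (fun j (t : Fin d × Fin d × Site d) => SideTouches (i.Ω j) t.2.2 t.2.1)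
      (fun t => covDerivFwd i.η U₀ t.1 (fun z => Ain z t.2.1) t.2.2) := ⟨_, rfl⟩
  obtain ⟨l4, hl4_def⟩ : ∃ l4 : ℝ, l4 = bondNorm L m i.η (-(3 : ℝ)) i.Ω (fun x μ => covLap i.η U₀ (fun z => A' z μ) x) := ⟨_, rfl⟩
  obtain ⟨g4, hg4_def⟩ : ∃ g4 : ℝ, g4 = bondNorm L m i.η (-(3 : ℝ)) i.Ω (fun x μ => covLap i.η U₀ (fun z => Ain z μ) x) := ⟨_, rfl⟩
  rw [← hl1_def] at hL1
  rw [← hl2_def, ← hg2_def] at hL2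
  rw [← hg2_def] at hA2
  rw [← hl4_def, ← hg4_def] at hL4
  rw [← hg4_def] at hA4
  rw [← hnJ_def, ← hnB_def, ← hΦ_def, hJJ, ← hl1_def, ← hl2_def, ← hl4_def]
  have hd4 : (1 : ℝ) ≤ 4 * d + 2 := by linarith only [hd1]
  refine ⟨?_, ?_, ?_, ?_⟩
  · exact collar_arith (e := 1) hB'1 hΦ0 hd4 (by linarith only [hL1, hA1])
  · exact collar_arith (e := 2) hB'1 hΦ0 (by linarith only [hd1]) (by linarith only [hL2, hA2])
  · refine collar_arith (e := 0) hB'1 hΦ0 (by linarith only [hd1]) ?_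
    have h1 : nJ ≤ B' * nJ := le_mul_of_one_le_left hnJ0 hB'1
    have h2 : 0 ≤ B' * (16 * d * Φ + nB) := by positivity
    calc nJ ≤ B' * nJ := h1
      _ ≤ B' * nJ + B' * (16 * d * Φ + nB) := le_add_of_nonneg_right h2
      _ = B' * (nJ + 16 * d * Φ + nB) + 0 * Φ := by ring
  · exact collar_arith (e := 4 * d) hB'1 hΦ0 (by linarith only [hd1]) (by linarith only [hL4, hA4])


/-- ★ **(`CurvAtInAk` currency.)  THEOREM 3.3 (BY NAME) SUPPLIES THE β COLLAR SOCKET AT EVERY MEMBER OF AN INDEX MAP WITH `Margin2`, EVERY TRUNCATION LEVEL `m ≤ k`, AT A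
MEMBER-WISE DATUM CLASS `ΛbP j` READ INSIDE `Ω₀`** (edition γ of `B9SupplySockB9P3ZdBeta.sockB9P3D4β_allLevels_of_thm33_on`: binder `AvgAtγ … (ΛbP j)`,
law `SeesDom` at the levels `m ≤ k`, socket `SockB9P3D4β … (ΛbP j)`; at `ΛbP j :=` print's class this is the edition-γ family supplier). [cite: Balaban1985RegularSpaces, (1.58)–(1.59) p.86, Thm 4 p.88, p.77; Balaban1985BackgroundPropagators, Thm 3.3 p.399, (3.27) p.395] -/
theorem sockB9P3D4γI_allLevels_of_thm33_on (hd2 : 2 ≤ d) (hL : 1 ≤ L) {c35 c₆ K₆ M₃ a₃ c69 q : ℝ}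
    {Gp : ∀ i, B9.KernelFamily (geo i) (bg i)} (h33 : B9.Thm33Printed c35 geo bg Gp GA)
    {J : Type*} (ι : J → ZdIdx d L) (hMJ : ∀ j, Margin2 (ι j).Ω)
    (hdict : ∀ (M : ℝ) (j : J) (m : ℕ), DictAt geo bg GA L mem ιCfg ιLoc ops M (ι j) m)
    (hP6 : ∀ (M : ℝ) (j : J) (m : ℕ), M₃ ≤ M → Prop6At bg L mem ιCfg c35 c₆ K₆ M (ι j) m)
    (hinv : ∀ (M : ℝ) (j : J) (m : ℕ), M₃ ≤ M → InvAt bg L mem ιCfg ops c35 a₃ M (ι j) m)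
    (hcurv : ∀ (M : ℝ) (j : J) (m : ℕ), M₃ ≤ M → CurvAtInAk L ops c69 M (ι j) m)
    (hlan : ∀ (M : ℝ) (j : J) (m : ℕ), M₃ ≤ M → LandauAt bg L mem ιCfg ops c35 a₃ M (ι j) m)
    (ΛbP : J → ℕ → ℕ → Set (Site d × Fin d)) (havg : ∀ (M : ℝ) (j : J) (m : ℕ), AvgAtγ L ops q (ΛbP j) M (ι j) m)
    (hsee : ∀ (j : J) (m : ℕ), m ≤ (ι j).k → SeesDom L m ((ι j).Ω 0) (ΛbP j))
    (hc₆ : 0 < c₆) (hK₆ : 0 < K₆) (ha₃ : 0 < a₃) (hc69 : 0 ≤ c69) (hq : 0 ≤ q) :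
    ∃ B₀ cP : ℝ, 0 < B₀ ∧ 0 < cP ∧
      ∀ (j : J) (m : ℕ), m ≤ (ι j).k →
        SockB9P3D4β (𝔸 := 𝔸) L (max 1 (2 * B₀ * max 1 q)) ((20 * d + 2) * max 1 (2 * B₀ * max 1 q)) cP
          (ι j).η m (ι j).Ω (ι j).Λs (ΛbP j) := by
  obtain ⟨M₁, δ₀, a₀, B₀, Bβ, Bε, Bεβ, -, -, ha₀, hB₀, H⟩ := h33
  obtain ⟨M, hM_def⟩ : ∃ M : ℝ, M = max 1 (max M₁ M₃) := ⟨_, rfl⟩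
  have hM1 : 1 ≤ M := by rw [hM_def]; exact le_max_left _ _
  have hMM₁ : M₁ ≤ M := by rw [hM_def]; exact (le_max_left _ _).trans (le_max_right _ _)
  have hMM₃ : M₃ ≤ M := by rw [hM_def]; exact (le_max_right _ _).trans (le_max_right _ _)
  have hM0 : 0 < M := lt_of_lt_of_le one_pos hM1
  have hKM : 0 < K₆ * M := mul_pos hK₆ hM0
  refine ⟨B₀, min (1 / 16) (min (c₆ / M) (min (a₀ / (K₆ * M)) (min (a₃ / (K₆ * M)) (1 / (2 * B₀ * c69 * M + 1))))),
    hB₀, ?_, fun j m hm => ?_⟩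
  · refine lt_min (by norm_num) (lt_min (div_pos hc₆ hM0) (lt_min (div_pos ha₀ hKM) (lt_min (div_pos ha₃ hKM) ?_)))
    have : 0 < 2 * B₀ * c69 * M + 1 := by positivity
    positivity
  · refine sockB9P3D4γI_at geo bg GA L mem ιCfg ιLoc ops hd2 hL hM1 (ι j) (hMJ j) (hdict M j m) (hP6 M j m hMM₃) (hinv M j m hMM₃)
      (hcurv M j m hMM₃) (hlan M j m hMM₃) (ΛbP j) (havg M j m) (hsee j m hm) hK₆ hc69 hq (δ₀ := δ₀) hB₀
      fun α₀ U₀ hU₀ hα₀ hMa hreg => ?_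
    have hMi : M₁ ≤ (geo (mem M (ι j) m)).M := by rw [(hdict M j m).1]; exact hMM₁
    have hMa' : (geo (mem M (ι j) m)).M * α₀ ≤ a₀ := by rw [(hdict M j m).1]; exact hMa
    exact (H (mem M (ι j) m) hMi α₀ hα₀ hMa' (ιCfg M (ι j) m U₀ hU₀) hreg).2.1

/-- ★ **(`CurvAtInAk` currency; EXPLICIT CONSTANTS.)  THE β COLLAR SOCKET FAMILY AT A MEMBER-WISE DATUM CLASS FROM THEOREM 3.3's `G(U)`-BLOCK AT NAMED CONSTANTS**
(edition γ of `B9SupplySockB9P3ZdBeta.sockB9P3D4β_allLevels_explicit_on`). [cite: Balaban1985RegularSpaces, (1.59) p.86, Thm 4 p.88, p.77; Balaban1985BackgroundPropagators, Thm 3.3 p.399] -/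
theorem sockB9P3D4γI_allLevels_explicit_on (hd2 : 2 ≤ d) (hL : 1 ≤ L) {c35 c₆ K₆ M₃ a₃ c69 q : ℝ}
    {M₁ δ₀ a₀ B₀ : ℝ} {Bβ Bε : ℝ → ℝ} {Bεβ : ℝ → ℝ → ℝ} (hB₀ : 0 < B₀)
    (H : ∀ i : I, M₁ ≤ (geo i).M → ∀ α₀ : ℝ, 0 < α₀ → (geo i).M * α₀ ≤ a₀ →
      ∀ U : (bg i).Cfg, (bg i).Reg335 c35 α₀ U →
        B9.Ineq342_346_347 (GA i) B₀ δ₀ U ∧ B9.Ineq343_345 (GA i) Bβ Bε Bεβ δ₀ U)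
    {M : ℝ} (hM1 : 1 ≤ M) (hMM₁ : M₁ ≤ M) (hMM₃ : M₃ ≤ M)
    {J : Type*} (ι : J → ZdIdx d L) (hMJ : ∀ j, Margin2 (ι j).Ω)
    (hdict : ∀ (M : ℝ) (j : J) (m : ℕ), DictAt geo bg GA L mem ιCfg ιLoc ops M (ι j) m)
    (hP6 : ∀ (M : ℝ) (j : J) (m : ℕ), M₃ ≤ M → Prop6At bg L mem ιCfg c35 c₆ K₆ M (ι j) m)
    (hinv : ∀ (M : ℝ) (j : J) (m : ℕ), M₃ ≤ M → InvAt bg L mem ιCfg ops c35 a₃ M (ι j) m)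
    (hcurv : ∀ (M : ℝ) (j : J) (m : ℕ), M₃ ≤ M → CurvAtInAk L ops c69 M (ι j) m)
    (hlan : ∀ (M : ℝ) (j : J) (m : ℕ), M₃ ≤ M → LandauAt bg L mem ιCfg ops c35 a₃ M (ι j) m)
    (ΛbP : J → ℕ → ℕ → Set (Site d × Fin d)) (havg : ∀ (M : ℝ) (j : J) (m : ℕ), AvgAtγ L ops q (ΛbP j) M (ι j) m)
    (hsee : ∀ (j : J) (m : ℕ), m ≤ (ι j).k → SeesDom L m ((ι j).Ω 0) (ΛbP j))
    (hK₆ : 0 < K₆) (hc69 : 0 ≤ c69) (hq : 0 ≤ q) :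
    ∀ (j : J) (m : ℕ), m ≤ (ι j).k →
      SockB9P3D4β (𝔸 := 𝔸) L (max 1 (2 * B₀ * max 1 q)) ((20 * d + 2) * max 1 (2 * B₀ * max 1 q))
        (min (1 / 16) (min (c₆ / M) (min (a₀ / (K₆ * M)) (min (a₃ / (K₆ * M)) (1 / (2 * B₀ * c69 * M + 1))))))
        (ι j).η m (ι j).Ω (ι j).Λs (ΛbP j) := by
  intro j m hm
  refine sockB9P3D4γI_at geo bg GA L mem ιCfg ιLoc ops hd2 hL hM1 (ι j) (hMJ j) (hdict M j m) (hP6 M j m hMM₃) (hinv M j m hMM₃)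
    (hcurv M j m hMM₃) (hlan M j m hMM₃) (ΛbP j) (havg M j m) (hsee j m hm) hK₆ hc69 hq (δ₀ := δ₀) hB₀
    fun α₀ U₀ hU₀ hα₀ hMa hreg => ?_
  have hMi : M₁ ≤ (geo (mem M (ι j) m)).M := by rw [(hdict M j m).1]; exact hMM₁
  have hMa' : (geo (mem M (ι j) m)).M * α₀ ≤ a₀ := by rw [(hdict M j m).1]; exact hMa
  exact (H (mem M (ι j) m) hMi α₀ hα₀ hMa' (ιCfg M (ι j) m U₀ hU₀) hreg).1


end Supply

/-! ## §3 A6 WITNESS — the hypothesis set of `sockB9P3D4γI_at` IS INHABITED at (a cube member, truncation `m = 0`) for every admissible class -/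

namespace Witness

open B8CubeMemberZd (cubeLamS cubeLamB cubeLamS_self)
open B9SupplySockB9P3ZdBeta.Witness (TB finite_TB_of_box massA opsW opsW_Gop geoW bgW GAW globW glob_bounds fp_unique phi_restr_of_eq extd_restr)

section Main

variable {𝔸₀ : Type} [CStarAlgebra 𝔸₀] [Nontrivial 𝔸₀]
variable {L : ℕ}

/-- ★★ **A6 WITNESS, EDITION γ·InAk: THE HYPOTHESIS SET OF `sockB9P3D4γI_at` IS INHABITED AT EVERY CUBE MEMBER OF (1.131), TRUNCATION `m = 0`, FOR EVERY
DATUM CLASS `ΛbP` WHOSE LEVEL-`0` SET AT TRUNCATION `0` CONTAINS EVERY INNER `□₀`-BOND AND CONSISTS OF `□₀`-BONDS** (the crossing bonds of `□₀` ride in the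
binder's own level-0 disjunct) (`d ≥ 2`, `L ≥ 1`, `ρ ≥ 2`; any C⋆-algebra
`𝔸₀ : Type`): there are a frame, member maps, letters and constants (`M = 1`, `K₆ = c₆ = a₃ = a₀ = B₀ = 1`, `c₆₉ = 0`, `q = aη²`) with `DictAt ∧ Prop6At ∧ InvAt ∧
CurvAt ∧ LandauAt ∧ AvgAtγ … ΛbP` at `(1, i, 0)`, `Margin2`, `SeesDom L 0 (i.Ω 0) ΛbP`, and Theorem 3.3's (3.42)∕(3.46)∕(3.47) block for every unitary `U₀` — the
witness letters and frame are `B9SupplySockB9P3ZdBeta.Witness.opsW ∕ geoW ∕ bgW ∕ GAW` (trivial massive regime) BY IMPORT, unchanged; NO hypothesis on the law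
field `i.Λb` any more (compare `B9SupplySockB9P3ZdBeta.Witness.binders_inhabited_cube_zero`, which needed `i.Λb = cubeLamB …`).  Print's class at the cube
member qualifies (`binders_inhabited_cubeLamBP_zero` below). [cite: Balaban1985BackgroundPropagators, Thm 3.3 p.399, (3.26)–(3.27) p.395, (3.47) p.398, (3.16) p.393; Balaban1985RegularSpaces, (1.58)–(1.59) p.86, (1.31) p.82, (1.131) p.99, p.77; Balaban1984PropagatorsII, (2.3) p.224] -/
theorem binders_inhabited_cube_zero_γI (hd2 : 2 ≤ d) (i : ZdIdx d L) {a : Site d} {Mc ρ : ℕ} (hρ : 2 ≤ ρ)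
    (hΩ : i.Ω = cubeFam false L a Mc ρ i.k) (ΛbP : ℕ → ℕ → Set (Site d × Fin d))
    (hcls : ∀ b : Site d × Fin d, b.1 ∈ i.Ω 0 → b.1 + e b.2 ∈ i.Ω 0 → b ∈ ΛbP 0 0)
    (hseeP : ∀ b ∈ ΛbP 0 0, BondTouches (i.Ω 0) b.1 b.2) :
    ∃ (I : Type) (geo : I → B9.Geometry) (bg : I → B9.Backgrounds) (GA : ∀ x, B9.KernelFamily (geo x) (bg x))
      (mem : ℝ → ZdIdx d L → ℕ → I)
      (ιCfg : ∀ (M : ℝ) (i' : ZdIdx d L) (m : ℕ) (U₀ : Site d → Fin d → 𝔸₀ˣ), (∀ x κ, U₀ x κ ∈ unitaryUnits 𝔸₀) → (bg (mem M i' m)).Cfg)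
      (ιLoc : ∀ (M : ℝ) (i' : ZdIdx d L) (m : ℕ), (Site d → Fin d → 𝔸₀) → (geo (mem M i' m)).Loc)
      (ops : ℝ → ZdIdx d L → ℕ → OpsZd d 𝔸₀) (c35 c₆ K₆ a₃ c69 q B₀ δ₀ a₀ : ℝ),
      0 < K₆ ∧ 0 ≤ c69 ∧ 0 ≤ q ∧ 0 < B₀ ∧ 0 < c₆ ∧ 0 < a₃ ∧ 0 < a₀ ∧ Margin2 i.Ω ∧ SeesDom L 0 (i.Ω 0) ΛbP ∧
      DictAt geo bg GA L mem ιCfg ιLoc ops 1 i 0 ∧ Prop6At bg L mem ιCfg c35 c₆ K₆ 1 i 0 ∧ InvAt bg L mem ιCfg ops c35 a₃ 1 i 0 ∧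
      CurvAtInAk L ops c69 1 i 0 ∧ LandauAt bg L mem ιCfg ops c35 a₃ 1 i 0 ∧ AvgAtγ L ops q ΛbP 1 i 0 ∧
      (∀ (α₀ : ℝ) (U₀ : Site d → Fin d → 𝔸₀ˣ) (hU₀ : ∀ x κ, U₀ x κ ∈ unitaryUnits 𝔸₀), 0 < α₀ → 1 * α₀ ≤ a₀ →
        (bg (mem 1 i 0)).Reg335 c35 α₀ (ιCfg 1 i 0 U₀ hU₀) → B9.Ineq342_346_347 (GA (mem 1 i 0)) B₀ δ₀ (ιCfg 1 i 0 U₀ hU₀)) := by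
  classical
  have hd : 1 ≤ d := le_trans one_le_two hd2
  have hη : 0 < i.η := i.hη
  have hdpos : (0 : ℝ) < d := by exact_mod_cast hd
  have ha : 0 < massA d i.η := by unfold massA; positivity
  have hΩ0 : i.Ω 0 = {x | InBox (sqLo L a ρ i.k 0) (sqHi L a Mc ρ i.k 0) x} := by
    rw [hΩ, cubeFam_false_zero]; ext x; simp [cube]
  haveI : Fintype (TB (i.Ω 0)) := by
    have hfin := finite_TB_of_box (d := d) (sqLo L a ρ i.k 0) (sqHi L a Mc ρ i.k 0)
    rw [← hΩ0] at hfin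
    exact hfin.fintype
  refine ⟨Unit, fun _ => geoW i, fun _ => bgW d 𝔸₀, fun _ => GAW i hd, fun _ _ _ => (), fun _ _ _ U₀ _ => U₀, fun _ _ _ J => J,
    fun _ _ _ => opsW (i.Ω 0) hd i.η i.hη, 0, 1, 1, 1, 0, massA d i.η * i.η ^ 2, 1, 0, 1,
    one_pos, le_rfl, by positivity, one_pos, one_pos, one_pos, one_pos, ?_, seesDom_zero_of_touch hseeP, ?_, ?_, ?_, ?_, ?_, ?_, ?_⟩
  · rw [hΩ]; exact B9SupplySockB9P3ZdLettersOmega.margin2_cubeFam L a Mc hρ i.k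
  · -- the norm dictionary: by construction of the frame
    refine ⟨rfl, fun U₀ hU₀ J => ⟨?_, ?_, ?_, ?_⟩⟩
    · simp [geoW]
    · simp [GAW, globW]
    · simp [GAW, globW]
    · simp [GAW, globW]
  · -- Proposition 6's class: `Reg335 := ⊤`
    intro _ _ _ _ _ _; trivial
  · -- (3.27): G(U₀) is a left inverse of Δ_a(U₀) = D*_{U₀}D_{U₀} + a on E(Ω₀)
    intro α₀ U₀ hU₀ _ _ _ A hA J hJ
    have hJ' : ∀ (y : Site d) (τ : Fin d), BondTouches (i.Ω 0) y τ →
        J y τ = Jcur i.η U₀ A τ y + (massA d i.η : ℂ) • A y τ := by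
      intro y τ hb
      rw [hJ y τ hb]
      simp [deltaAOf, opsW]
    have hfix := fp_unique (i.Ω 0) hd hη hU₀ J (phi_restr_of_eq (i.Ω 0) hη hd U₀ hA.1 hJ')
    show (opsW (i.Ω 0) hd i.η i.hη).Gop U₀ J = A
    rw [opsW_Gop (i.Ω 0) hd hη hU₀, ← hfix, extd_restr (i.Ω 0) hA.1]
  · -- (3.69): `Δ′ := 0`
    intro α₀ U₀ hU₀ hα₀ _ A _ j _ x μ _
    show ((L : ℝ) ^ j * i.η) ^ 3 * ‖(0 : 𝔸₀)‖ ≤ 0 * 1 * α₀ * _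
    simp
  · -- the Landau letter: `DRD* := 0`
    intro _ _ _ _ _ _ _ _ _ _ _; rfl
  · -- (3.16) in the β currency: `Q*aQ := a·1`, `q := aη²`; every Ω₀-bond is a level-0 constraint bond or a crossing bond
    intro U₀ hU₀ A hA j hj x μ hb
    obtain rfl : j = 0 := Nat.le_zero.mp hj
    show ((L : ℝ) ^ 0 * i.η) ^ 3 * ‖(massA d i.η : ℂ) • A x μ‖ ≤ _
    obtain ⟨c, hc⟩ := hA.2
    have e1 : (-(1 : ℝ)) = -((1 : ℕ) : ℝ) := by norm_num
    have hw1 : weight L i.η (-(1 : ℝ)) 0 = i.η := by rw [e1, B8ScaledSupNorm.weight_neg_natCast, pow_zero, one_mul, pow_one]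
    have hside : ∀ (y : Site d) (τ : Fin d), BondTouches (i.Ω 0) y τ → SideTouches (i.Ω 0) y τ := fun y τ h => by
      obtain ⟨κ, hκ⟩ := B9SupplySockB9P3ZdSocketBoundaryMode.exists_ne_fin hd2 τ
      exact B8Eq140Level.sideTouches_of_bondTouches hκ h
    have hnormA : ∀ (y : Site d) (τ : Fin d), BondTouches (i.Ω 0) y τ → i.η * ‖A y τ‖ ≤ c := fun y τ h => by
      have := hc 0 le_rfl (y, τ) (hside y τ h); rwa [hw1] at this
    have hbd : ∀ p : {p : ℕ × (Site d × Fin d) // p.1 ≤ 0 ∧ (p.2 ∈ ΛbP 0 p.1 ∨ (p.1 = 0 ∧ CrossB (i.Ω 0) p.2))},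
        1 * ‖linCovIter L U₀ (iEta i.η A) p.1.1 p.1.2.1 p.1.2.2‖ ≤ c := by
      rintro ⟨⟨j', b⟩, hj', hb'⟩
      obtain rfl : j' = 0 := Nat.le_zero.mp hj'
      have hbt : BondTouches (i.Ω 0) b.1 b.2 := by
        rcases hb' with hmem | ⟨-, hcr⟩
        · exact hseeP b hmem
        · exact hcr.1
      dsimp only
      rw [one_mul, B7Prop4GeneralLevels.linCovIter_zero, iEta, norm_smul, norm_mul, Complex.norm_I, one_mul, Complex.norm_real,
        Real.norm_of_nonneg hη.le]
      exact hnormA b.1 b.2 hbt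
    have hidx : (x, μ) ∈ ΛbP 0 0 ∨ ((0 : ℕ) = 0 ∧ CrossB (i.Ω 0) (x, μ)) := by
      by_cases hin : x ∈ i.Ω 0 ∧ x + e μ ∈ i.Ω 0
      · exact Or.inl (hcls (x, μ) hin.1 hin.2)
      · exact Or.inr ⟨rfl, hb, hin⟩
    have hle := B8Eq155JBound.le_wsup hbd ⟨(0, (x, μ)), le_rfl, hidx⟩
    dsimp only at hle
    rw [one_mul, B7Prop4GeneralLevels.linCovIter_zero, iEta, norm_smul, norm_mul, Complex.norm_I, one_mul, Complex.norm_real,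
      Real.norm_of_nonneg hη.le] at hle
    rw [pow_zero, one_mul, norm_smul, Complex.norm_real, Real.norm_of_nonneg ha.le]
    calc i.η ^ 3 * (massA d i.η * ‖A x μ‖) = (massA d i.η * i.η ^ 2) * (i.η * ‖A x μ‖) := by ring
      _ ≤ (massA d i.η * i.η ^ 2) * _ := mul_le_mul_of_nonneg_left hle (by positivity)
  · -- Theorem 3.3's (3.42)∕(3.46)∕(3.47) block for G(U₀): local entries vanish, the γ = −3 globals by `glob_bounds`
    intro α₀ U₀ hU₀ _ _ _
    refine ⟨fun n lam y y' _ => by simp [GAW, geoW], fun n lam h y y' _ _ => by simp [GAW, geoW], fun n lam γ _ _ => ?_⟩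
    show (GAW i hd).glob n U₀ lam γ ≤ 1 * (geoW i).wNorm γ lam
    by_cases hγ : γ = -3
    · subst hγ; simp only [GAW, geoW, if_true, one_mul]; exact glob_bounds i hd hη rfl hU₀ lam n
    · simp [GAW, geoW, hγ]

/-- ★ **THE A6 WITNESS AT PRINT'S CLASS OF THE CUBE MEMBER**: `binders_inhabited_cube_zero_γI` at `ΛbP := cubeLamBP L a M ρ k` — at truncation `0` the class IS the set
of `□₀`-bonds (`mem_cubeLamBP_zero_of_bondTouches`, `cubeLamBP_zero_bondTouches`). [cite: Balaban1984PropagatorsII, (2.3) p.224; Balaban1985RegularSpaces, (1.59) p.86, (1.131) p.99; Balaban1985BackgroundPropagators, Thm 3.3 p.399] -/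
theorem binders_inhabited_cubeLamBP_zero_I (hd2 : 2 ≤ d) (i : ZdIdx d L) {a : Site d} {Mc ρ : ℕ} (hρ : 2 ≤ ρ)
    (hΩ : i.Ω = cubeFam false L a Mc ρ i.k) :
    ∃ (I : Type) (geo : I → B9.Geometry) (bg : I → B9.Backgrounds) (GA : ∀ x, B9.KernelFamily (geo x) (bg x))
      (mem : ℝ → ZdIdx d L → ℕ → I)
      (ιCfg : ∀ (M : ℝ) (i' : ZdIdx d L) (m : ℕ) (U₀ : Site d → Fin d → 𝔸₀ˣ), (∀ x κ, U₀ x κ ∈ unitaryUnits 𝔸₀) → (bg (mem M i' m)).Cfg)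
      (ιLoc : ∀ (M : ℝ) (i' : ZdIdx d L) (m : ℕ), (Site d → Fin d → 𝔸₀) → (geo (mem M i' m)).Loc)
      (ops : ℝ → ZdIdx d L → ℕ → OpsZd d 𝔸₀) (c35 c₆ K₆ a₃ c69 q B₀ δ₀ a₀ : ℝ),
      0 < K₆ ∧ 0 ≤ c69 ∧ 0 ≤ q ∧ 0 < B₀ ∧ 0 < c₆ ∧ 0 < a₃ ∧ 0 < a₀ ∧ Margin2 i.Ω ∧ SeesDom L 0 (i.Ω 0) (cubeLamBP L a Mc ρ i.k) ∧
      DictAt geo bg GA L mem ιCfg ιLoc ops 1 i 0 ∧ Prop6At bg L mem ιCfg c35 c₆ K₆ 1 i 0 ∧ InvAt bg L mem ιCfg ops c35 a₃ 1 i 0 ∧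
      CurvAtInAk L ops c69 1 i 0 ∧ LandauAt bg L mem ιCfg ops c35 a₃ 1 i 0 ∧ AvgAtγ L ops q (cubeLamBP L a Mc ρ i.k) 1 i 0 ∧
      (∀ (α₀ : ℝ) (U₀ : Site d → Fin d → 𝔸₀ˣ) (hU₀ : ∀ x κ, U₀ x κ ∈ unitaryUnits 𝔸₀), 0 < α₀ → 1 * α₀ ≤ a₀ →
        (bg (mem 1 i 0)).Reg335 c35 α₀ (ιCfg 1 i 0 U₀ hU₀) → B9.Ineq342_346_347 (GA (mem 1 i 0)) B₀ δ₀ (ιCfg 1 i 0 U₀ hU₀)) := by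
  have hΩ0 : i.Ω 0 = cube L a Mc ρ i.k 0 := by rw [hΩ, cubeFam_false_zero]
  exact binders_inhabited_cube_zero_γI hd2 i hρ hΩ _
    (fun b hb _ => mem_cubeLamBP_zero_of_bondTouches L a Mc ρ i.k (by rw [← hΩ0]; exact Or.inl hb))
    (fun b hb => by rw [hΩ0]; exact cubeLamBP_zero_bondTouches L a Mc ρ i.k 0 hb)

end Main

end Witness

end Literature.MathematicalPhysics.QuantumFieldTheory.Balaban1983to89.B9SupplySockB9P3ZdGammaInAk

end
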